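import Summits.QuantumFields.GaugeBoot.SchwingerDysonPair
import Literature.MathematicalPhysics.QuantumLattice.RepLieAlgebraUnitary
import Literature.MathematicalPhysics.QuantumLattice.CPeriodicBoundaryConditions
import HarnessLib

/-!
# Charge-conjugation invariance of the torus Wilson state (cell `gauge-boot`, seat lean2, desk item)

Honest framing (cell rule): certified bounds on lattice expectations at stated coupling, gauge group, dimension and
torus size; NOT a mass gap, NOT a continuum limit, NOT a string tension, NOT large `N`; not summit-bearing
(`FixedCouplingUltralocality`, `PerturbativeInvisibility`).  This file enters NO bound, NO certificate and NO index row: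
it is the one measure-theoretic lemma sized in the lane's design note `SU3-ROWS-DESIGN.md` §3(a).

## Content

* **Continuous automorphisms acting on every link.**  For a compact group `G` and a continuous group automorphism
  `φ : G ≃ₜ* G`, holonomies of the configuration `e ↦ φ (U e)` are the images of those of `U`
  (`plaquetteHolonomy_comp`, `wordHolonomy_comp`); `φ` preserves the Haar probability measure
  (`measurePreserving_haarProbability_continuousMulEquiv`: uniqueness of the normalised Haar measure, Mathlib
  `MonoidHom.measurePreserving`) and so `U ↦ φ ∘ U` preserves the product Haar measure of the links
  (`measurePreserving_pi_haarProbability_comp`); and if the real character of the action is `φ`-invariant,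
  `Re tr ρ(φ g) = Re tr ρ(g)` (`wilsonAction_comp`), then Wilson's measure `μ_β = Z⁻¹ exp(−β S) ∏ dHaar` of the torus
  `(ℤ/L)^d` is invariant under `U ↦ φ ∘ U` for every real `β`, every `d` and every `L ≥ 1`
  (`wilsonMeasure_map_comp_continuousMulEquiv`, `measurePreserving_comp_continuousMulEquiv`,
  `integral_comp_continuousMulEquiv`, `wilsonExpectation_comp_continuousMulEquiv`) — the pattern of the tree's
  `wilsonMeasure_map_configPerm`.  (The tree's `map_wilsonMeasure_of_mulEquiv` transports the state along an
  isomorphism of MODELS, `ρ = ρ' ∘ e`; charge conjugation is not of that form — `ρ(Ū) = conj ρ(U) ≠ ρ(U)` — only the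
  real character is preserved, which is all the Wilson weight sees.)
* **Charge conjugation for `SU(N)`.**  With the tree's entrywise complex conjugation `suConj N : SU(N) →* SU(N)`
  (`CPeriodicBoundaryConditions`; continuous and involutive, `suConj_suConj`) one has `tr Ū = conj (tr U)`
  (`trace_fundamentalRep_suConj`), hence `Re tr`-invariance: the torus Wilson state of lattice `SU(N)` Yang–Mills
  (fundamental representation, tree coupling `β`) is charge-conjugation invariant (`measurePreserving_suConj_wilsonMeasure`,
  `wilsonMeasure_map_suConj`, `integral_comp_suConj`, `wilsonExpectation_comp_suConj`).  Consequences: every observable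
  with `F(Ū) = conj F(U)` has REAL expectation (`conj_integral_eq_of_suConj`, `im_integral_eq_zero_of_suConj`); in
  particular every multi-loop expectation `E[∏ᵢ tr hol_{xᵢ}(wᵢ)]` of complex (unnormalised) Wilson-loop traces is
  real (`im_integral_prod_trace_wordHolonomy_eq_zero`, `im_integral_trace_wordHolonomy_eq_zero`,
  `integral_im_trace_wordHolonomy_eq_zero`), and a loop and its reverse have the same complex expectation
  (`integral_trace_wordHolonomy_reverse`).  For `SU(2)` these are pointwise trivial (`tr U ∈ ℝ`); for `SU(3)` they
  are the reality of the single- and double-trace loop variables and the dictionary `d⁻(A, B) = d⁺(A, B⁻¹)` of the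
  design note (an `SU(3)` bootstrap needs no imaginary parts and one complex orientation per pair).

Everything is `[folklore]`: charge-conjugation (`C`) symmetry of the Wilson action, e.g. M. Creutz, *Quarks, gluons and
lattices* (1983) Ch. 8; I. Montvay, G. Münster, *Quantum Fields on a Lattice* (1994) §3.2.  No loop equation, no
positivity block and no certificate is here; `SU(3)` certificate rows have no ruling and are not started.
-/

noncomputable section

open MeasureTheory
open scoped Matrix ComplexConjugate
open Literature.MathematicalPhysics.QuantumFieldTheory

namespace Summit.QuantumFields.GaugeBoot

/-! ## A group endomorphism applied to every link: algebra -/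

section Algebra

variable {d L N : ℕ} {G : Type*} [Group G]

/-- Plaquette holonomies of `e ↦ φ (U e)` are the images of those of `U`. [folklore] -/
theorem plaquetteHolonomy_comp (φ : G →* G) (U : GaugeConfig d L G) (x : Site d L) (i j : Fin d) :
    plaquetteHolonomy (fun e => φ (U e)) x i j = φ (plaquetteHolonomy U x i j) := by
  simp only [plaquetteHolonomy, map_mul, map_inv]

/-- Step holonomies of `e ↦ φ (U e)` are the images of those of `U`. [folklore] -/
theorem stepHolonomy_comp (φ : G →* G) (U : GaugeConfig d L G) (x : Site d L) (s : Step d) :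
    stepHolonomy (fun e => φ (U e)) x s = φ (stepHolonomy U x s) := by
  cases s <;> simp only [stepHolonomy, map_inv]

/-- Word holonomies of `e ↦ φ (U e)` are the images of those of `U`. [folklore] -/
theorem wordHolonomy_comp (φ : G →* G) (U : GaugeConfig d L G) :
    ∀ (x : Site d L) (w : Word d), wordHolonomy (fun e => φ (U e)) x w = φ (wordHolonomy U x w)
  | x, [] => by simp only [wordHolonomy_nil, map_one]
  | x, s :: w => by
    rw [wordHolonomy_cons, wordHolonomy_cons, map_mul, stepHolonomy_comp, wordHolonomy_comp φ U _ w]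

/-- The Wilson action of `e ↦ φ (U e)` equals that of `U` when the real character `Re tr ρ` is `φ`-invariant.
[folklore] -/
theorem wilsonAction_comp [NeZero L] (ρ : G →* Matrix (Fin N) (Fin N) ℂ) (φ : G →* G)
    (hφ : ∀ g, (ρ (φ g)).trace.re = (ρ g).trace.re) (U : GaugeConfig d L G) :
    wilsonAction ρ (fun e => φ (U e)) = wilsonAction ρ U := by
  simp only [wilsonAction, plaquetteHolonomy_comp, hφ]

end Algebra

/-! ## A continuous automorphism applied to every link: the Wilson measure is invariant -/

section Measure

variable {d L N : ℕ} {G : Type*} [Group G] [TopologicalSpace G] [IsTopologicalGroup G] [CompactSpace G]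
  [MeasurableSpace G] [BorelSpace G]

/-- **A continuous automorphism of a compact group preserves the Haar probability measure** (uniqueness of the
normalised Haar measure; Mathlib `MonoidHom.measurePreserving`). [folklore] -/
theorem measurePreserving_haarProbability_continuousMulEquiv (φ : G ≃ₜ* G) :
    MeasurePreserving φ (haarProbability G) (haarProbability G) :=
  MonoidHom.measurePreserving (f := φ.toMulEquiv.toMonoidHom) φ.continuous φ.surjective rfl

/-- `U ↦ φ ∘ U` preserves the product Haar measure of the links (Mathlib `measurePreserving_pi`). [folklore] -/
theorem measurePreserving_pi_haarProbability_comp [NeZero L] (φ : G ≃ₜ* G) :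
    MeasurePreserving (fun (U : GaugeConfig d L G) (e : Edge d L) => φ (U e))
      (Measure.pi fun _ : Edge d L => haarProbability G) (Measure.pi fun _ : Edge d L => haarProbability G) :=
  measurePreserving_pi (fun _ : Edge d L => haarProbability G) (fun _ : Edge d L => haarProbability G)
    fun _ => measurePreserving_haarProbability_continuousMulEquiv φ

variable (ρ : G →* Matrix (Fin N) (Fin N) ℂ)

/-- **The torus Wilson state is invariant under a continuous automorphism of the gauge group that preserves the
character `Re tr ρ`** (every real `β`, every `d`, every `L ≥ 1`): the product Haar measure is invariant and so is
the density `exp(−β S)`. [folklore] -/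
theorem wilsonMeasure_map_comp_continuousMulEquiv [NeZero L] (φ : G ≃ₜ* G)
    (hφ : ∀ g, (ρ (φ g)).trace.re = (ρ g).trace.re) (β : ℝ) :
    (wilsonMeasure ρ β).map (fun (U : GaugeConfig d L G) (e : Edge d L) => φ (U e)) =
      wilsonMeasure (d := d) (L := L) (G := G) ρ β := by
  let E : GaugeConfig d L G ≃ᵐ GaugeConfig d L G :=
    MeasurableEquiv.arrowCongr' (Equiv.refl (Edge d L)) φ.toHomeomorph.toMeasurableEquiv
  have hE : (E : GaugeConfig d L G → GaugeConfig d L G) = fun U e => φ (U e) := rfl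
  simp only [wilsonMeasure, Measure.map_smul, wilsonWeight]
  rw [← hE, withDensity_map_of_measurableEquiv _ E _
    (hE ▸ (measurePreserving_pi_haarProbability_comp (d := d) (L := L) φ).map_eq)]
  intro U
  rw [hE]
  exact congrArg (fun s : ℝ => ENNReal.ofReal (Real.exp (-β * s))) (wilsonAction_comp ρ φ.toMulEquiv.toMonoidHom hφ U)

/-- `U ↦ φ ∘ U` is measure preserving for the torus Wilson state. [folklore] -/
theorem measurePreserving_comp_continuousMulEquiv [NeZero L] (φ : G ≃ₜ* G)
    (hφ : ∀ g, (ρ (φ g)).trace.re = (ρ g).trace.re) (β : ℝ) :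
    MeasurePreserving (fun (U : GaugeConfig d L G) (e : Edge d L) => φ (U e))
      (wilsonMeasure (d := d) (L := L) ρ β) (wilsonMeasure (d := d) (L := L) ρ β) :=
  ⟨(measurePreserving_pi_haarProbability_comp (d := d) (L := L) φ).measurable,
    wilsonMeasure_map_comp_continuousMulEquiv ρ φ hφ β⟩

/-- Torus Wilson integrals are invariant under `U ↦ φ ∘ U`. [folklore] -/
theorem integral_comp_continuousMulEquiv [NeZero L] {V : Type*} [NormedAddCommGroup V] [NormedSpace ℝ V]
    (φ : G ≃ₜ* G) (hφ : ∀ g, (ρ (φ g)).trace.re = (ρ g).trace.re) (β : ℝ) (F : GaugeConfig d L G → V) :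
    ∫ U, F (fun e => φ (U e)) ∂(wilsonMeasure (d := d) (L := L) ρ β) =
      ∫ U, F U ∂(wilsonMeasure (d := d) (L := L) ρ β) :=
  (measurePreserving_comp_continuousMulEquiv ρ φ hφ β).integral_comp
    (MeasurableEquiv.arrowCongr' (Equiv.refl (Edge d L)) φ.toHomeomorph.toMeasurableEquiv).measurableEmbedding F

/-- Torus Wilson expectations are invariant under `U ↦ φ ∘ U`. [folklore] -/
theorem wilsonExpectation_comp_continuousMulEquiv [NeZero L] {V : Type*} [NormedAddCommGroup V]
    [NormedSpace ℝ V] (φ : G ≃ₜ* G) (hφ : ∀ g, (ρ (φ g)).trace.re = (ρ g).trace.re) (β : ℝ)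
    (F : GaugeConfig d L G → V) :
    wilsonExpectation ρ β (fun U => F (fun e => φ (U e))) = wilsonExpectation (d := d) (L := L) ρ β F :=
  integral_comp_continuousMulEquiv ρ φ hφ β F

end Measure

/-! ## Charge conjugation on `SU(N)` -/

section SUN

open Literature.MathematicalPhysics.QuantumLattice

variable (N : ℕ)

/-- `tr Ū = conj (tr U)` in the fundamental representation (`suConj` = entrywise conjugation, tree
`CPeriodicBoundaryConditions`). [folklore] -/
theorem trace_fundamentalRep_suConj (A : Matrix.specialUnitaryGroup (Fin N) ℂ) :
    (fundamentalRep (Fin N) (suConj N A)).trace = conj (fundamentalRep (Fin N) A).trace := by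
  rw [fundamentalRep_apply, fundamentalRep_apply, coe_suConj, ← AddMonoidHom.map_trace]

/-- `Re tr Ū = Re tr U`: the Wilson character is charge-conjugation invariant. [folklore] -/
theorem re_trace_fundamentalRep_suConj (A : Matrix.specialUnitaryGroup (Fin N) ℂ) :
    (fundamentalRep (Fin N) (suConj N A)).trace.re = (fundamentalRep (Fin N) A).trace.re := by
  rw [trace_fundamentalRep_suConj, Complex.conj_re]

variable {d L : ℕ}

/-- **Charge-conjugation invariance of lattice `SU(N)` Yang–Mills on the torus**: for every real `β`, every `d` and
every `L ≥ 1`, `U ↦ Ū` (every link conjugated) is measure preserving for Wilson's measure — `suConj N` packaged as a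
continuous involutive automorphism and fed to `measurePreserving_comp_continuousMulEquiv`. [folklore] -/
theorem measurePreserving_suConj_wilsonMeasure [NeZero L] (β : ℝ) :
    MeasurePreserving (fun (U : GaugeConfig d L (Matrix.specialUnitaryGroup (Fin N) ℂ)) (e : Edge d L) => suConj N (U e))
      (wilsonMeasure (d := d) (L := L) (fundamentalRep (Fin N)) β)
      (wilsonMeasure (d := d) (L := L) (fundamentalRep (Fin N)) β) := by
  have hc : Continuous (suConj N) :=
    Continuous.subtype_mk (continuous_subtype_val.matrix_map Complex.continuous_conj) _
  have hinv : (suConj N).comp (suConj N) = MonoidHom.id _ := MonoidHom.ext (suConj_suConj N)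
  let φ : Matrix.specialUnitaryGroup (Fin N) ℂ ≃ₜ* Matrix.specialUnitaryGroup (Fin N) ℂ :=
    { (suConj N).toMulEquiv (suConj N) hinv hinv with continuous_toFun := hc, continuous_invFun := hc }
  exact measurePreserving_comp_continuousMulEquiv (fundamentalRep (Fin N)) φ (re_trace_fundamentalRep_suConj N) β

/-- The push-forward of Wilson's measure under `U ↦ Ū` is Wilson's measure. [folklore] -/
theorem wilsonMeasure_map_suConj [NeZero L] (β : ℝ) :
    (wilsonMeasure (fundamentalRep (Fin N)) β).map
        (fun (U : GaugeConfig d L (Matrix.specialUnitaryGroup (Fin N) ℂ)) (e : Edge d L) => suConj N (U e)) =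
      wilsonMeasure (d := d) (L := L) (fundamentalRep (Fin N)) β :=
  (measurePreserving_suConj_wilsonMeasure N β).map_eq

/-- Charge conjugation leaves every torus Wilson integral unchanged. [folklore] -/
theorem integral_comp_suConj [NeZero L] {V : Type*} [NormedAddCommGroup V] [NormedSpace ℝ V] (β : ℝ)
    (F : GaugeConfig d L (Matrix.specialUnitaryGroup (Fin N) ℂ) → V) :
    ∫ U, F (fun e => suConj N (U e)) ∂(wilsonMeasure (d := d) (L := L) (fundamentalRep (Fin N)) β) =
      ∫ U, F U ∂(wilsonMeasure (d := d) (L := L) (fundamentalRep (Fin N)) β) := by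
  have hinv : Function.Involutive
      fun (U : GaugeConfig d L (Matrix.specialUnitaryGroup (Fin N) ℂ)) (e : Edge d L) => suConj N (U e) :=
    fun U => funext fun e => suConj_suConj N (U e)
  exact (measurePreserving_suConj_wilsonMeasure N β).integral_comp
    (MeasurableEquiv.ofInvolutive _ hinv (measurePreserving_suConj_wilsonMeasure (d := d) (L := L) N β).measurable
      ).measurableEmbedding F

/-- Charge conjugation leaves every torus Wilson expectation unchanged. [folklore] -/
theorem wilsonExpectation_comp_suConj [NeZero L] {V : Type*} [NormedAddCommGroup V] [NormedSpace ℝ V] (β : ℝ)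
    (F : GaugeConfig d L (Matrix.specialUnitaryGroup (Fin N) ℂ) → V) :
    wilsonExpectation (fundamentalRep (Fin N)) β (fun U => F (fun e => suConj N (U e))) =
      wilsonExpectation (d := d) (L := L) (fundamentalRep (Fin N)) β F :=
  integral_comp_suConj N β F

/-- **Conjugation-covariant observables have real expectation**: if `F(Ū) = conj F(U)` then `conj E[F] = E[F]`.
[folklore] -/
theorem conj_integral_eq_of_suConj [NeZero L] (β : ℝ)
    {F : GaugeConfig d L (Matrix.specialUnitaryGroup (Fin N) ℂ) → ℂ} (hF : ∀ U, F (fun e => suConj N (U e)) = conj (F U)) :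
    conj (∫ U, F U ∂(wilsonMeasure (d := d) (L := L) (fundamentalRep (Fin N)) β)) =
      ∫ U, F U ∂(wilsonMeasure (d := d) (L := L) (fundamentalRep (Fin N)) β) := by
  rw [← integral_conj, ← integral_comp_suConj N β F]
  exact integral_congr_ae (ae_of_all _ fun U => (hF U).symm)

/-- If `F(Ū) = conj F(U)` then `Im E[F] = 0`. [folklore] -/
theorem im_integral_eq_zero_of_suConj [NeZero L] (β : ℝ)
    {F : GaugeConfig d L (Matrix.specialUnitaryGroup (Fin N) ℂ) → ℂ} (hF : ∀ U, F (fun e => suConj N (U e)) = conj (F U)) :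
    (∫ U, F U ∂(wilsonMeasure (d := d) (L := L) (fundamentalRep (Fin N)) β)).im = 0 := by
  have h := congrArg Complex.im (conj_integral_eq_of_suConj N β hF)
  rw [Complex.conj_im] at h
  linarith

/-! ### Wilson loops -/

/-- The holonomy of a word in the conjugated configuration is the conjugated holonomy. [folklore] -/
theorem wordHolonomy_suConj (U : GaugeConfig d L (Matrix.specialUnitaryGroup (Fin N) ℂ)) (x : Site d L) (w : Word d) :
    wordHolonomy (fun e => suConj N (U e)) x w = suConj N (wordHolonomy U x w) :=
  wordHolonomy_comp (suConj N) U x w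

/-- `tr hol_x(w)(Ū) = conj tr hol_x(w)(U)`. [folklore] -/
theorem trace_wordHolonomy_suConj (U : GaugeConfig d L (Matrix.specialUnitaryGroup (Fin N) ℂ)) (x : Site d L)
    (w : Word d) :
    (fundamentalRep (Fin N) (wordHolonomy (fun e => suConj N (U e)) x w)).trace =
      conj (fundamentalRep (Fin N) (wordHolonomy U x w)).trace := by
  rw [wordHolonomy_suConj, trace_fundamentalRep_suConj]

/-- **Multi-loop expectations are real**: `Im E[∏ᵢ tr hol_{xᵢ}(wᵢ)] = 0` for every finite family of based words
(the single- and double-trace loop variables of an `SU(N)` bootstrap need no imaginary parts). [folklore] -/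
theorem im_integral_prod_trace_wordHolonomy_eq_zero [NeZero L] (β : ℝ) {ι : Type*} (s : Finset ι)
    (x : ι → Site d L) (w : ι → Word d) :
    (∫ U, ∏ i ∈ s, (fundamentalRep (Fin N) (wordHolonomy U (x i) (w i))).trace
      ∂(wilsonMeasure (d := d) (L := L) (fundamentalRep (Fin N)) β)).im = 0 :=
  im_integral_eq_zero_of_suConj N β fun U => by simp only [map_prod, trace_wordHolonomy_suConj]

/-- **Wilson-loop expectations are real**: `Im E[tr hol_x(w)] = 0`. [folklore] -/
theorem im_integral_trace_wordHolonomy_eq_zero [NeZero L] (β : ℝ) (x : Site d L) (w : Word d) :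
    (∫ U, (fundamentalRep (Fin N) (wordHolonomy U x w)).trace
      ∂(wilsonMeasure (d := d) (L := L) (fundamentalRep (Fin N)) β)).im = 0 :=
  im_integral_eq_zero_of_suConj N β fun U => trace_wordHolonomy_suConj N U x w

/-- `E[Im tr hol_x(w)] = 0`. [folklore] -/
theorem integral_im_trace_wordHolonomy_eq_zero [NeZero L] (β : ℝ) (x : Site d L) (w : Word d) :
    ∫ U, (fundamentalRep (Fin N) (wordHolonomy U x w)).trace.im
      ∂(wilsonMeasure (d := d) (L := L) (fundamentalRep (Fin N)) β) = 0 := by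
  have hcont : Continuous fun U : GaugeConfig d L (Matrix.specialUnitaryGroup (Fin N) ℂ) =>
      (fundamentalRep (Fin N) (wordHolonomy U x w)).trace :=
    ((continuous_fundamentalRep (Fin N)).comp (continuous_wordHolonomy x w)).matrix_trace
  have hint : Integrable (fun U : GaugeConfig d L (Matrix.specialUnitaryGroup (Fin N) ℂ) =>
      (fundamentalRep (Fin N) (wordHolonomy U x w)).trace) (wilsonMeasure (d := d) (L := L) (fundamentalRep (Fin N)) β) :=
    integrable_of_continuous (fundamentalLatticeRep N) β hcont
  have h := integral_im hint
  simp only [RCLike.im_to_complex] at h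
  rw [h, im_integral_trace_wordHolonomy_eq_zero]

/-- **A loop and its reverse have the same complex expectation**: `E[tr hol(w⁻¹)] = E[tr hol(w)]` (pointwise
`tr hol(w⁻¹) = conj tr hol(w)`, then reality). [folklore] -/
theorem integral_trace_wordHolonomy_reverse [NeZero L] (β : ℝ) (x : Site d L) (w : Word d) :
    ∫ U, (fundamentalRep (Fin N) (wordHolonomy U (Word.endpoint x w) (Word.reverse w))).trace
        ∂(wilsonMeasure (d := d) (L := L) (fundamentalRep (Fin N)) β) =
      ∫ U, (fundamentalRep (Fin N) (wordHolonomy U x w)).trace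
        ∂(wilsonMeasure (d := d) (L := L) (fundamentalRep (Fin N)) β) := by
  have h : ∀ U : GaugeConfig d L (Matrix.specialUnitaryGroup (Fin N) ℂ),
      (fundamentalRep (Fin N) (wordHolonomy U (Word.endpoint x w) (Word.reverse w))).trace =
        conj (fundamentalRep (Fin N) (wordHolonomy U x w)).trace := fun U => by
    rw [wordHolonomy_reverse, fundamentalRep_apply, fundamentalRep_apply, ← Matrix.star_eq_inv,
      Matrix.specialUnitaryGroup.coe_star, Matrix.star_eq_conjTranspose, Matrix.trace_conjTranspose,
      Complex.star_def]
  simp_rw [h]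
  rw [integral_conj, conj_integral_eq_of_suConj N β fun U => trace_wordHolonomy_suConj N U x w]

end SUN

end Summit.QuantumFields.GaugeBoot

end
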